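import Literature.Barriers.CriticalPhenomena.PlaquetteWalkAngleLimitCoefficient
import Literature.Probability.RandomPlanarGeometry.YangBaxterSAWStripMonotone
import Mathlib.Algebra.Polynomial.Expand
import HarnessLib

/-!
# Barrier catalogue (SAWScalingLimit): the COST PARITY LAW of the printed Yang–Baxter family — the cleared vertex
functional is a polynomial in `Z²`, so the zero-angle bound halves («COST PARITY»)

Continuation of `PlaquetteWalkAngleLimitCoefficient` (`cost_s(γ) = n_{u₁} + n_{u₂} + [s vertical]`, `deg(term) + cost = 4K + 1`).

* `ParitySupp ε p` — a polynomial supported on the exponents `≡ ε (mod 2)`; closure under `+, −, ·, ^, Σ`; the six cleared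
  weight polynomials of #312 are EVEN except `Z²·u₁·Den`, `Z²·u₂·Den` which are ODD; hence every walk term is supported on the
  parity of `n_{u₁} + n_{u₂} + slotDeg` (`paritySupp_termPoly`).
* ★ `countP_turnB_arcsOf_mod_two` (telescoping: the number of turning arcs of a mid-edge list has the parity of «first and last
  orientations differ») and ★ `countP_turnB_eq_sum_faces` (arcs to plaquettes: the number of turning arcs of a walk is the sum
  over its visited plaquettes of the non-straight entries of their kinds lists), whence ★★ `cfgCount_corner_add_coCorner_mod_two`:
  `n_{u₁} + n_{u₂} ≡ [orientation of a ≠ orientation of z] (mod 2)` for every Glazman–Manolescu walk from `a` to `z`.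
* ★★ COST PARITY LAW `cost_mod_two`: every walk from a VERTICAL root has ODD limit cost, every walk from a SLANTED root EVEN cost
  (the census law «c_w ∈ {5,7,9}» vs «{4,6,8}» of FINDING-YB-LIMIT-MODEL); ★★ `paritySupp_ybVFPoly`: the cleared functional
  `P` is supported on one parity — `P(Z) = Z^ε·Q(Z²)`.
* ★★★ `vertexFunctional_printed_zero_count_half` — EITHER the printed vertex functional vanishes at every `θ ∈ (0, π)`, OR its zero
  angles there number at most `2K + 1` (`K = maxExp`): HALF of #312's `4K + 1`, because `θ ↦ Z(θ)² = e^{3iθ/4}` is still injective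
  on `(0, π)`.

Elementary (list bookkeeping + `Polynomial.expand/contract`); recorded because the lane's encircling-criterion statements count zero angles.
-/

noncomputable section

namespace Literature.Barriers.CriticalPhenomena.PlaquetteWalk

open Literature.Probability.RandomPlanarGeometry.SAW.YangBaxter
open Real Complex Polynomial

/-! ## Parity-supported polynomials -/

section ParityPoly

/-- A polynomial is supported on the exponents of parity `ε` (`ε = 0`: even polynomial, `ε = 1`: odd). [cite: GlazmanManolescu2019, §1, eq. (1) (lane plumbing)] -/
def ParitySupp (ε : ℕ) (p : ℂ[X]) : Prop := ∀ d : ℕ, d % 2 ≠ ε % 2 → p.coeff d = 0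

/-- `0` is supported on every parity. [cite: GlazmanManolescu2019, §1, eq. (1) (lane plumbing)] -/
theorem ParitySupp.zero (ε : ℕ) : ParitySupp ε 0 := fun _ _ => coeff_zero _

/-- Constants are even. [cite: GlazmanManolescu2019, §1, eq. (1) (lane plumbing)] -/
theorem ParitySupp.C (c : ℂ) : ParitySupp 0 (C c) := by
  intro d hd
  rw [coeff_C]
  have : d ≠ 0 := by intro h; simp [h] at hd
  simp [this]

/-- `X` is odd. [cite: GlazmanManolescu2019, §1, eq. (1) (lane plumbing)] -/
theorem ParitySupp.X : ParitySupp 1 (X : ℂ[X]) := by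
  intro d hd
  rw [coeff_X]
  have : (1 : ℕ) ≠ d := by intro h; subst h; simp at hd
  simp [this]

/-- Sums of polynomials of the same parity. [cite: GlazmanManolescu2019, §1, eq. (1) (lane plumbing)] -/
theorem ParitySupp.add {ε : ℕ} {p q : ℂ[X]} (hp : ParitySupp ε p) (hq : ParitySupp ε q) : ParitySupp ε (p + q) :=
  fun d hd => by rw [coeff_add, hp d hd, hq d hd, add_zero]

/-- Differences of polynomials of the same parity. [cite: GlazmanManolescu2019, §1, eq. (1) (lane plumbing)] -/
theorem ParitySupp.sub {ε : ℕ} {p q : ℂ[X]} (hp : ParitySupp ε p) (hq : ParitySupp ε q) : ParitySupp ε (p - q) :=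
  fun d hd => by rw [coeff_sub, hp d hd, hq d hd, sub_zero]

/-- Products add parities. [cite: GlazmanManolescu2019, §1, eq. (1) (lane plumbing)] -/
theorem ParitySupp.mul {ε₁ ε₂ : ℕ} {p q : ℂ[X]} (hp : ParitySupp ε₁ p) (hq : ParitySupp ε₂ q) :
    ParitySupp (ε₁ + ε₂) (p * q) := by
  intro d hd
  rw [coeff_mul]
  refine Finset.sum_eq_zero fun x hx => ?_
  rw [Finset.mem_antidiagonal] at hx
  by_cases h1 : x.1 % 2 = ε₁ % 2
  · have h2 : x.2 % 2 ≠ ε₂ % 2 := by intro h2; apply hd; omega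
    rw [hq _ h2, mul_zero]
  · rw [hp _ h1, zero_mul]

/-- Powers multiply the parity. [cite: GlazmanManolescu2019, §1, eq. (1) (lane plumbing)] -/
theorem ParitySupp.pow {ε : ℕ} {p : ℂ[X]} (hp : ParitySupp ε p) (n : ℕ) : ParitySupp (n * ε) (p ^ n) := by
  induction n with
  | zero => simpa using ParitySupp.C 1
  | succ n ih =>
    rw [pow_succ]
    have := ih.mul hp
    convert this using 2
    ring

/-- Finite sums of polynomials of one parity. [cite: GlazmanManolescu2019, §1, eq. (1) (lane plumbing)] -/
theorem ParitySupp.sum {ι : Type*} {ε : ℕ} (s : Finset ι) (f : ι → ℂ[X]) (h : ∀ i ∈ s, ParitySupp ε (f i)) :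
    ParitySupp ε (∑ i ∈ s, f i) := by
  intro d hd
  rw [finsetSum_coeff]
  exact Finset.sum_eq_zero fun i hi => h i hi d hd

/-- Changing `ε` by an even amount. [cite: GlazmanManolescu2019, §1, eq. (1) (lane plumbing)] -/
theorem ParitySupp.of_mod_eq {ε ε' : ℕ} {p : ℂ[X]} (hp : ParitySupp ε p) (h : ε % 2 = ε' % 2) : ParitySupp ε' p :=
  fun d hd => hp d (by omega)

/-- An even polynomial is the expansion of its contraction: `p = Q(X²)`, `Q = contract 2 p`. [folklore] -/
private theorem expand_contract_two {p : ℂ[X]} (hp : ParitySupp 0 p) : expand ℂ 2 (contract 2 p) = p := by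
  ext n
  rw [coeff_expand two_pos, coeff_contract two_ne_zero]
  split_ifs with h
  · rw [Nat.div_mul_cancel h]
  · exact (hp n (by omega)).symm

/-- The contraction of a polynomial of degree `≤ N` has degree `≤ N / 2`. [folklore] -/
private theorem natDegree_contract_two_le {p : ℂ[X]} {N : ℕ} (h : p.natDegree ≤ N) : (contract 2 p).natDegree ≤ N / 2 := by
  refine (natDegree_le_iff_coeff_eq_zero).2 fun n hn => ?_
  rw [coeff_contract two_ne_zero]
  exact coeff_eq_zero_of_natDegree_lt (by omega)

end ParityPoly

/-! ## Parity of the cleared weight polynomials -/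

section FactorParity

/-- `P⁺_α` is even. [cite: GlazmanManolescu2019, §1, eq. (1)] -/
theorem paritySupp_sinPolyP (α : ℝ) : ParitySupp 0 (sinPolyP α) := by
  unfold sinPolyP
  have h := (ParitySupp.C (Complex.exp ((α : ℂ) * I) * I / 2)).mul (ParitySupp.X.pow 2)
  exact (ParitySupp.C _).sub (h.of_mod_eq (by norm_num))

/-- `P⁻_β` is even. [cite: GlazmanManolescu2019, §1, eq. (1)] -/
theorem paritySupp_sinPolyM (β : ℝ) : ParitySupp 0 (sinPolyM β) := by
  unfold sinPolyM
  have h := (ParitySupp.C (Complex.exp (-((β : ℂ) * I)) * I / 2)).mul (ParitySupp.X.pow 2)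
  exact (h.of_mod_eq (by norm_num)).sub (ParitySupp.C _)

/-- `Z²·Den` is even. [cite: GlazmanManolescu2019, §1, eq. (1)] -/
theorem paritySupp_ybDenPoly : ParitySupp 0 ybDenPoly :=
  ((paritySupp_sinPolyP _).mul (paritySupp_sinPolyM _)).of_mod_eq (by norm_num)

/-- `Z²·v·Den` is even. [cite: GlazmanManolescu2019, §1, eq. (1)] -/
theorem paritySupp_ybVPoly : ParitySupp 0 ybVPoly :=
  ((paritySupp_sinPolyP _).mul (paritySupp_sinPolyM _)).of_mod_eq (by norm_num)

/-- `Z²·w₁·Den` is even. [cite: GlazmanManolescu2019, §1, eq. (1)] -/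
theorem paritySupp_ybW1Poly : ParitySupp 0 ybW1Poly :=
  ((paritySupp_sinPolyP _).mul (paritySupp_sinPolyM _)).of_mod_eq (by norm_num)

/-- `Z²·w₂·Den` is even. [cite: GlazmanManolescu2019, §1, eq. (1)] -/
theorem paritySupp_ybW2Poly : ParitySupp 0 ybW2Poly :=
  ((paritySupp_sinPolyP _).mul (paritySupp_sinPolyM _)).of_mod_eq (by norm_num)

/-- `Z²·u₁·Den` is ODD: a single corner arc flips the parity. [cite: GlazmanManolescu2019, §1, eq. (1)] -/
theorem paritySupp_ybU1Poly : ParitySupp 1 ybU1Poly := by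
  unfold ybU1Poly
  exact (((ParitySupp.C _).mul ParitySupp.X).mul (paritySupp_sinPolyP _)).of_mod_eq (by norm_num)

/-- `Z²·u₂·Den` is ODD. [cite: GlazmanManolescu2019, §1, eq. (1)] -/
theorem paritySupp_ybU2Poly : ParitySupp 1 ybU2Poly := by
  unfold ybU2Poly
  exact (((ParitySupp.C _).mul ParitySupp.X).mul (paritySupp_sinPolyP _)).of_mod_eq (by norm_num)

/-- The values of `slotDeg`. [cite: GlazmanManolescu2019, Lemma 2.1, eq. (CR) (lane plumbing)] -/
private theorem slotDeg_vals : slotDeg 0 = 0 ∧ slotDeg 1 = 1 ∧ slotDeg 2 = 0 ∧ slotDeg 3 = 1 := by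
  refine ⟨?_, ?_, ?_, ?_⟩ <;> decide

/-- The slot coefficient has the parity of its degree (`0` on `E, W`, `1` on `N, S`). [cite: GlazmanManolescu2019, Lemma 2.1, eq. (CR)] -/
theorem paritySupp_ybCoeffPoly (s : Fin 4) : ParitySupp (slotDeg s) (ybCoeffPoly s) := by
  obtain ⟨h0, h1, h2, h3⟩ := slotDeg_vals
  fin_cases s
  · simp only [ybCoeffPoly, Fin.zero_eta, Matrix.cons_val_zero, Fin.isValue, h0]
    exact ParitySupp.C 1
  · simp only [ybCoeffPoly, Fin.mk_one, Matrix.cons_val_one, Matrix.cons_val_zero, Fin.isValue, h1]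
    exact ((ParitySupp.C _).mul ParitySupp.X).of_mod_eq (by norm_num)
  · simp only [ybCoeffPoly, Fin.reduceFinMk, Matrix.cons_val, h2]
    exact ParitySupp.C _
  · simp only [ybCoeffPoly, Fin.reduceFinMk, Matrix.cons_val, h3]
    exact ((ParitySupp.C _).mul ParitySupp.X).of_mod_eq (by norm_num)

/-- ★ **A walk term is supported on ONE parity — that of its degree `4K + 1 − cost`**, i.e. of
`n_{u₁} + n_{u₂} + slotDeg`. [cite: GlazmanManolescu2019, §1, eq. (1); Lemma 2.1, eq. (CR)] -/
theorem paritySupp_termPoly (s : Fin 4) (l : List MidEdge) (K : ℕ) :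
    ParitySupp (cfgCount l [.corner] + cfgCount l [.coCorner] + slotDeg s) (termPoly s l K) := by
  unfold termPoly ybWalkPoly
  have hU1 := paritySupp_ybU1Poly.pow (cfgCount l [.corner])
  have hU2 := paritySupp_ybU2Poly.pow (cfgCount l [.coCorner])
  have hV := paritySupp_ybVPoly.pow (cfgCount l [.straight])
  have hW1 := paritySupp_ybW1Poly.pow (cfgCount l [.corner, .corner])
  have hW2 := paritySupp_ybW2Poly.pow (cfgCount l [.coCorner, .coCorner])
  have hD := paritySupp_ybDenPoly.pow (K - totalExp l)
  have hC := ParitySupp.C (tFiveEighths ^ quarterTurnsL l)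
  have hwalk := (((hU1.mul hU2).mul hV).mul hW1).mul hW2
  have h := (paritySupp_ybCoeffPoly s).mul ((hC.mul hwalk).mul hD)
  refine h.of_mod_eq ?_
  omega

end FactorParity

/-! ## Orientation of mid-edges and the parity of the number of turning arcs -/

section Orientation

/-- A mid-edge is vertical (`vert`, the W/E sides of rhombi) or slanted (`slant`, the S/N sides). [cite: GlazmanManolescu2019, §1 (the tiling and its edges)] -/
def vertB : MidEdge → Bool
  | .vert _ _ => true
  | .slant _ _ => false

/-- The W and E sides are vertical, the S and N sides slanted. [cite: GlazmanManolescu2019, §1, Fig. 4] -/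
theorem vertB_side (f : Face) :
    vertB (f.side .W) = true ∧ vertB (f.side .E) = true ∧ vertB (f.side .S) = false ∧ vertB (f.side .N) = false :=
  ⟨rfl, rfl, rfl, rfl⟩

/-- The slots `E, W` (degree `0`) are vertical, `N, S` (degree `1`) slanted. [cite: GlazmanManolescu2019, Lemma 2.1, eq. (CR)] -/
theorem vertB_slotSide (f₀ : Face) (s : Fin 4) : vertB (slotSide f₀ s) = (slotDeg s == 0) := by
  fin_cases s <;> rfl

/-- An arc TURNS when its two mid-edges have different orientations. [cite: GlazmanManolescu2019, §1, Fig. 1 (lane plumbing)] -/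
def turnB (p : MidEdge × MidEdge) : Bool := vertB p.1 != vertB p.2

/-- A straight arc joins two sides of the same orientation; a corner or co-corner arc two sides of different
orientations. [cite: GlazmanManolescu2019, §1, Fig. 1] -/
theorem arcKind_eq_straight_iff {s t : Side} (hst : s ≠ t) (f : Face) :
    arcKind s t = .straight ↔ vertB (f.side s) = vertB (f.side t) := by
  obtain ⟨hW, hE, hS, hN⟩ := vertB_side f
  cases s <;> cases t <;> simp [arcKind, hW, hE, hS, hN] at hst ⊢

/-- `arcsOf` of a list with at least two entries. [folklore] -/
private theorem arcsOf_cons_cons (x y : MidEdge) (l : List MidEdge) : arcsOf (x :: y :: l) = (x, y) :: arcsOf (y :: l) := rfl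

/-- Boolean bookkeeping of the telescoping step. [folklore] -/
private theorem telescope_aux (bx by_ bz : Bool) :
    ((if by_ = bz then 0 else 1) + if (bx != by_) = true then 1 else 0) % 2 = if bx = bz then 0 else 1 := by
  cases bx <;> cases by_ <;> cases bz <;> simp

/-- ★ **TELESCOPING**: the number of turning arcs of a mid-edge list has the parity of `[first and last orientations differ]`.
[cite: GlazmanManolescu2019, §1 (the tiling; lane plumbing)] -/
theorem countP_turnB_arcsOf_mod_two (x : MidEdge) (l : List MidEdge) :
    (arcsOf (x :: l)).countP turnB % 2 = if vertB x = vertB ((x :: l).getLast (List.cons_ne_nil x l)) then 0 else 1 := by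
  induction l generalizing x with
  | nil => simp
  | cons y l ih =>
    rw [arcsOf_cons_cons, List.countP_cons, List.getLast_cons (List.cons_ne_nil y l)]
    have key := ih y
    have hmod : ((arcsOf (y :: l)).countP turnB + if turnB (x, y) = true then 1 else 0) % 2 =
        ((arcsOf (y :: l)).countP turnB % 2 + if turnB (x, y) = true then 1 else 0) % 2 := by
      split_ifs <;> omega
    rw [hmod, key]
    exact telescope_aux (vertB x) (vertB y) (vertB ((y :: l).getLast (List.cons_ne_nil y l)))

end Orientation

/-! ## From arcs to plaquettes: the number of turning arcs and `n_{u₁} + n_{u₂}` have the same parity -/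

section FaceAccounting

/-- Counting through a `filterMap`. [folklore] -/
private theorem countP_filterMap' {α β : Type*} (g : α → Option β) (q : β → Bool) (A : List α) :
    (A.filterMap g).countP q = A.countP fun x => (g x).elim false q := by
  induction A with
  | nil => simp
  | cons x A ih =>
    rw [List.filterMap_cons, List.countP_cons]
    cases hx : g x with
    | none => simp [ih]
    | some y => simp [List.countP_cons, ih]

/-- A Kronecker sum over a duplicate-free list picks out one term. [folklore] -/
private theorem sum_map_ite_eq_of_nodup {β : Type*} [DecidableEq β] (F : List β) (hF : F.Nodup) {f₀ : β} (h : f₀ ∈ F) :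
    (F.map fun f => if f₀ = f then 1 else 0).sum = 1 := by
  have e : ∀ F : List β, (F.map fun f => if f₀ = f then 1 else 0).sum = F.count f₀ := by
    intro F
    induction F with
    | nil => simp
    | cons f F ih =>
      rw [List.map_cons, List.sum_cons, ih, List.count_cons]
      by_cases hf : f = f₀
      · subst hf; simp [add_comm]
      · have : ¬f₀ = f := fun e => hf e.symm
        simp [hf, this]
  rw [e, List.count_eq_one_of_mem hF h]

/-- ★ **FIBREWISE COUNTING**: summing, over a duplicate-free list of faces, the number of the arcs with a given property that
lie in that face, gives the number of all arcs with the property — provided every such arc lies in a listed face.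
[folklore] -/
private theorem sum_map_countP_fibre {α β : Type*} [DecidableEq β] (φ : α → Option β) (P : α → Bool) (F : List β)
    (hF : F.Nodup) :
    ∀ A : List α, (∀ p ∈ A, P p = true → ∃ f ∈ F, φ p = some f) →
      (F.map fun f => A.countP fun p => decide (φ p = some f) && P p).sum = A.countP P
  | [], _ => by simp
  | p :: A, hA => by
    have hA' : ∀ q ∈ A, P q = true → ∃ f ∈ F, φ q = some f := fun q hq => hA q (List.mem_cons_of_mem _ hq)
    have ih := sum_map_countP_fibre φ P F hF A hA'
    simp only [List.countP_cons]
    have split : (F.map fun f => (A.countP fun p => decide (φ p = some f) && P p) +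
        if (decide (φ p = some f) && P p) = true then 1 else 0).sum =
        (F.map fun f => A.countP fun p => decide (φ p = some f) && P p).sum +
          (F.map fun f => if (decide (φ p = some f) && P p) = true then 1 else 0).sum := by
      rw [← List.sum_map_add]
    rw [split, ih]
    congr 1
    by_cases hp : P p = true
    · obtain ⟨f₀, hf₀, hφ⟩ := hA p List.mem_cons_self hp
      rw [if_pos hp]
      have e : (F.map fun f => if (decide (φ p = some f) && P p) = true then 1 else 0) =
          F.map fun f => if f₀ = f then 1 else 0 := by
        refine List.map_congr_left fun f _ => ?_
        by_cases h : f₀ = f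
        · subst h; simp [hφ, hp]
        · have : φ p ≠ some f := by rw [hφ]; exact fun e => h (Option.some_injective _ e)
          simp [this, h]
      rw [e, sum_map_ite_eq_of_nodup F hF hf₀]
    · rw [if_neg hp]
      have e : (F.map fun f => if (decide (φ p = some f) && P p) = true then 1 else 0) = F.map fun _ => 0 := by
        refine List.map_congr_left fun f _ => ?_
        simp [hp]
      rw [e]; simp

variable {D : Set Face} {a z : MidEdge}

/-- The kinds list of a plaquette never contains a degenerate arc and its turning entries are counted by `turnB`:
for a walk, an arc in the face `f` turns iff its kind is not straight. [cite: GlazmanManolescu2019, §1, Fig. 1] -/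
private theorem elim_arcKindOf_eq_turnB (γ : YBWalk D a z) {p : MidEdge × MidEdge} (hp : p ∈ arcsOf γ.mids) :
    (arcKindOf p).elim false (fun k => !decide (k = ArcKind.straight)) = turnB p := by
  obtain ⟨f, -, hpf⟩ := γ.arc_mem p hp
  obtain ⟨s, t, hst, hs, ht, hk⟩ := exists_sides_of_arcFace hpf
  rw [hk]
  simp only [Option.elim_some, turnB]
  have key := arcKind_eq_straight_iff hst f
  rw [hs, ht] at key
  by_cases h : arcKind s t = .straight
  · have h2 := key.1 h
    simp [h, h2]
  · have h2 : vertB p.1 ≠ vertB p.2 := fun e => h (key.2 e)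
    simp only [h, decide_false, Bool.not_false]
    cases h1 : vertB p.1 <;> cases h3 : vertB p.2 <;> simp_all

/-- The number of non-straight entries of the kinds list of `f`, as a count over the arcs. [cite: GlazmanManolescu2019, §1, Fig. 1] -/
private theorem countP_kindsL_eq (γ : YBWalk D a z) (f : Face) :
    (kindsL γ.mids f).countP (fun k => !decide (k = ArcKind.straight)) =
      (arcsOf γ.mids).countP fun p => decide (arcFace p = some f) && turnB p := by
  unfold kindsL
  rw [countP_filterMap']
  refine List.countP_congr fun p hp => ?_
  by_cases h : arcFace p = some f
  · rw [if_pos h, elim_arcKindOf_eq_turnB γ hp]; simp [h]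
  · rw [if_neg h]; simp [h]

/-- ★ **ARCS TO PLAQUETTES**: the number of turning arcs of a walk is the sum over its visited plaquettes of the numbers of
non-straight entries of their kinds lists. [cite: GlazmanManolescu2019, §1 ("the weight of a walk is the product of weights associated to each rhombus")] -/
theorem countP_turnB_eq_sum_faces (γ : YBWalk D a z) :
    (arcsOf γ.mids).countP turnB =
      ((facesL γ.mids).map fun f => (kindsL γ.mids f).countP fun k => !decide (k = ArcKind.straight)).sum := by
  classical
  have hF : (facesL γ.mids).Nodup := List.nodup_dedup _
  have hcov : ∀ p ∈ arcsOf γ.mids, turnB p = true → ∃ f ∈ facesL γ.mids, arcFace p = some f := by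
    intro p hp _
    obtain ⟨f, -, hpf⟩ := γ.arc_mem p hp
    refine ⟨f, ?_, hpf⟩
    unfold facesL
    rw [List.mem_dedup, List.mem_filterMap]
    exact ⟨p, hp, hpf⟩
  rw [← sum_map_countP_fibre arcFace turnB (facesL γ.mids) hF (arcsOf γ.mids) hcov]
  congr 1
  refine List.map_congr_left fun f _ => ?_
  rw [countP_kindsL_eq γ f]

/-- The non-straight count of a kinds list of a walk, modulo `2`: `1` exactly for the single-corner and single-co-corner
plaquettes. [cite: GlazmanManolescu2019, §1, Fig. 1 (the six local pictures)] -/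
private theorem countP_kindsL_mod_two (γ : YBWalk D a z) (f : Face) :
    (kindsL γ.mids f).countP (fun k => !decide (k = ArcKind.straight)) % 2 =
      if kindsL γ.mids f = [.corner] ∨ kindsL γ.mids f = [.coCorner] then 1 else 0 := by
  rcases kindsL_shape γ f with h | h | h | h | h | h <;> rw [h] <;> simp

/-- Disjoint alternatives add up in a count. [folklore] -/
private theorem countP_or_eq {β : Type*} (F : List β) (A B : β → Prop) [DecidablePred A] [DecidablePred B]
    (h : ∀ f, ¬(A f ∧ B f)) :
    (F.map fun f => if A f ∨ B f then 1 else 0).sum = F.countP (fun f => decide (A f)) + F.countP (fun f => decide (B f)) := by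
  induction F with
  | nil => simp
  | cons f F ih =>
    rw [List.map_cons, List.sum_cons, ih, List.countP_cons, List.countP_cons]
    by_cases hA : A f <;> by_cases hB : B f
    · exact absurd ⟨hA, hB⟩ (h f)
    · simp [hA, hB]; omega
    · simp [hA, hB]; omega
    · simp [hA, hB]

/-- ★★ **THE PARITY OF THE NUMBER OF ISOLATED TURNS**: for every walk, `n_{u₁} + n_{u₂}` (the number of plaquettes with
exactly one corner arc) has the parity of `[the orientations of the first and last mid-edges differ]`.
[cite: GlazmanManolescu2019, §1, Fig. 1] -/
theorem cfgCount_corner_add_coCorner_mod_two (γ : YBWalk D a z) :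
    (cfgCount γ.mids [.corner] + cfgCount γ.mids [.coCorner]) % 2 = if vertB a = vertB z then 0 else 1 := by
  classical
  -- the list is `a :: rest` with last element `z`
  obtain ⟨rest, hl⟩ : ∃ rest, γ.mids = a :: rest := by
    cases hm : γ.mids with
    | nil => have := γ.head_eq; rw [hm] at this; simp at this
    | cons x rest => have := γ.head_eq; rw [hm] at this; simp at this; exact ⟨rest, by rw [this]⟩
  have hlast : (a :: rest).getLast (List.cons_ne_nil a rest) = z := by
    have := γ.getLast_eq; rw [hl, List.getLast?_eq_getLast_of_ne_nil (List.cons_ne_nil a rest)] at this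
    simpa using this
  have tele := countP_turnB_arcsOf_mod_two a rest
  rw [hlast, ← hl, countP_turnB_eq_sum_faces γ, List.sum_nat_mod, List.map_map] at tele
  have e : ((facesL γ.mids).map ((fun x => x % 2) ∘ fun f => (kindsL γ.mids f).countP fun k => !decide (k = ArcKind.straight))) =
      (facesL γ.mids).map fun f => if kindsL γ.mids f = [.corner] ∨ kindsL γ.mids f = [.coCorner] then 1 else 0 := by
    refine List.map_congr_left fun f _ => ?_
    simp only [Function.comp]
    exact countP_kindsL_mod_two γ f
  rw [e, countP_or_eq _ _ _ (fun f hf => by rw [hf.1] at hf; exact absurd hf.2 (by decide))] at tele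
  unfold cfgCount
  have hc : ((facesL γ.mids).countP fun f => decide (kindsL γ.mids f = [ArcKind.corner])) +
      ((facesL γ.mids).countP fun f => decide (kindsL γ.mids f = [ArcKind.coCorner])) =
      ((facesL γ.mids).countP fun f => kindsL γ.mids f = [ArcKind.corner]) +
        ((facesL γ.mids).countP fun f => kindsL γ.mids f = [ArcKind.coCorner]) := rfl
  omega

end FaceAccounting

/-! ## The cost parity law and the halved zero count -/

section CostParity

variable (Dl : List Face) (a : MidEdge) (f₀ : Face)

/-- ★★ **COST PARITY LAW**: every walk from a VERTICAL root has ODD limit cost, every walk from a SLANTED root EVEN limit cost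
(`cost_s(γ) = n_{u₁} + n_{u₂} + [s vertical]`). [cite: GlazmanManolescu2019, §1, Fig. 1; Lemma 2.1, eq. (CR)] -/
theorem cost_mod_two (s : Fin 4) (γ : YBWalk (dom Dl) a (slotSide f₀ s)) :
    cost s γ.mids % 2 = if vertB a then 1 else 0 := by
  have h := cfgCount_corner_add_coCorner_mod_two γ
  rw [vertB_slotSide] at h
  have hs : slotDeg s ≤ 1 := by unfold slotDeg; split_ifs <;> simp
  unfold cost
  by_cases hv : vertB a = true
  · rw [hv] at h ⊢; simp only [if_true]
    by_cases hd : slotDeg s = 0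
    · simp [hd] at h; omega
    · have hd1 : slotDeg s = 1 := by omega
      simp [hd1] at h; omega
  · have hv' : vertB a = false := by simpa using hv
    rw [hv'] at h ⊢; simp only [Bool.false_eq_true, if_false]
    by_cases hd : slotDeg s = 0
    · simp [hd] at h; omega
    · have hd1 : slotDeg s = 1 := by omega
      simp [hd1] at h; omega

/-- The parity class of the root: `0` (even exponents) for a vertical root, `1` for a slanted root. [cite: GlazmanManolescu2019, §1] -/
def rootParity (a : MidEdge) : ℕ := if vertB a then 0 else 1

/-- ★★ **THE CLEARED VERTEX FUNCTIONAL IS SUPPORTED ON ONE PARITY OF EXPONENTS** — even powers of `Z` for a vertical root,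
odd powers for a slanted root: `P(Z) = Z^ε·Q(Z²)`. [cite: GlazmanManolescu2019, Lemma 2.1 and eq. (1)] -/
theorem paritySupp_ybVFPoly {K : ℕ} (hK : maxExp Dl a f₀ ≤ K) : ParitySupp (rootParity a) (ybVFPoly Dl a f₀ K) := by
  rw [ybVFPoly_eq_sum_termPoly]
  refine ParitySupp.sum _ _ fun s _ => ParitySupp.sum _ _ fun γ _ => ?_
  refine (paritySupp_termPoly s γ.mids K).of_mod_eq ?_
  have hc := cost_mod_two Dl a f₀ s γ
  have hdeg := natDegree_termPoly_add_cost s (K := K) (totalExp_le_of_maxExp_le Dl a f₀ hK s γ)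
  unfold cost at hc
  unfold rootParity
  have hs : slotDeg s ≤ 1 := by unfold slotDeg; split_ifs <;> simp
  by_cases hv : vertB a = true
  · rw [if_pos hv] at hc ⊢; omega
  · rw [if_neg hv] at hc ⊢; omega

/-- `Z(θ₁)² = Z(θ₂)²` with both angles in `(0, π)` forces `θ₁ = θ₂` (the exponent `3θ/4` moves by less than `2π`). [folklore] -/
private theorem eq_of_Zθ_sq_eq {θ₁ θ₂ : ℝ} (h₁ : θ₁ ∈ Set.Ioo 0 π) (h₂ : θ₂ ∈ Set.Ioo 0 π) (h : Zθ θ₁ ^ 2 = Zθ θ₂ ^ 2) :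
    θ₁ = θ₂ := by
  have e : ∀ θ : ℝ, Zθ θ ^ 2 = Complex.exp (((3 * θ / 4 : ℝ) : ℂ) * I) := by
    intro θ; rw [Zθ, sq, ← Complex.exp_add]; congr 1; push_cast; ring
  rw [e, e] at h
  obtain ⟨n, hn⟩ := Complex.exp_eq_exp_iff_exists_int.1 h
  have him := congrArg Complex.im hn
  simp only [Complex.mul_im, Complex.ofReal_re, Complex.ofReal_im, Complex.I_re, Complex.I_im, mul_zero, mul_one,
    add_zero, Complex.add_im, Complex.mul_re, Complex.intCast_re, Complex.intCast_im, zero_mul, sub_zero,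
    Complex.re_ofNat, Complex.im_ofNat] at him
  have hb : |(3 * θ₁ / 4 - 3 * θ₂ / 4 : ℝ)| < 2 * π := by
    rw [abs_lt]; constructor <;> nlinarith [h₁.1, h₁.2, h₂.1, h₂.2, Real.pi_pos]
  have hn0 : (n : ℝ) = 0 := by
    by_contra hne
    have h1 : (1 : ℝ) ≤ |(n : ℝ)| := by
      rw [← Int.cast_abs]; exact_mod_cast Int.one_le_abs (fun e => hne (by simp [e]))
    have h2 : 2 * π ≤ |(3 * θ₁ / 4 - 3 * θ₂ / 4 : ℝ)| := by
      rw [show (3 * θ₁ / 4 - 3 * θ₂ / 4 : ℝ) = n * (2 * π) by linarith, abs_mul, abs_of_pos Real.two_pi_pos]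
      nlinarith [Real.pi_pos, h1]
    linarith
  have e2 : 3 * θ₁ / 4 = 3 * θ₂ / 4 := by
    have := him; rw [hn0, zero_mul, add_zero] at this; exact this
  linarith

/-- ★★★ **THE HALVED ZERO COUNT**: for every finite face list, root and plaquette, EITHER the printed vertex functional vanishes at
every `θ ∈ (0, π)`, OR its zero angles in `(0, π)` number at most `2K + 1`, `K = maxExp` — half of #312's `4K + 1`, because
`P(Z) = Z^ε·Q(Z²)` with `deg Q ≤ 2K + 1` and `θ ↦ Z(θ)²` injective on `(0, π)`. [cite: GlazmanManolescu2019, Lemma 2.1 and eq. (1)] -/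
theorem vertexFunctional_printed_zero_count_half (Dl : List Face) (a : MidEdge) (f₀ : Face) :
    (∀ θ ∈ Set.Ioo 0 π, vertexFunctional (printedWeights θ) tFiveEighths (ybCoeff θ) Dl a f₀ = 0) ∨
      ({θ ∈ Set.Ioo 0 π | vertexFunctional (printedWeights θ) tFiveEighths (ybCoeff θ) Dl a f₀ = 0}.Finite ∧
        {θ ∈ Set.Ioo 0 π | vertexFunctional (printedWeights θ) tFiveEighths (ybCoeff θ) Dl a f₀ = 0}.ncard ≤
          2 * maxExp Dl a f₀ + 1) := by
  set K := maxExp Dl a f₀ with hKdef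
  set P := ybVFPoly Dl a f₀ K with hP
  -- the even polynomial `R = X^ε · P` and its contraction `Q`
  set R : ℂ[X] := X ^ rootParity a * P with hR
  have hReven : ParitySupp 0 R := by
    have h := ((ParitySupp.X).pow (rootParity a)).mul (paritySupp_ybVFPoly Dl a f₀ (K := K) le_rfl)
    refine h.of_mod_eq ?_
    unfold rootParity; split_ifs <;> norm_num
  set Q := contract 2 R with hQ
  have hRQ : expand ℂ 2 Q = R := expand_contract_two hReven
  have key : ∀ θ ∈ Set.Ioo 0 π, (Zθ θ ^ 2 * ((weightDen θ : ℝ) : ℂ)) ^ K *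
      vertexFunctional (printedWeights θ) tFiveEighths (ybCoeff θ) Dl a f₀ = P.eval (Zθ θ) :=
    fun θ hθ => vertexFunctional_printed_eq_eval Dl a f₀ le_rfl (weightDen_ne_zero_of_mem_Ioo hθ)
  have hA : ∀ θ ∈ Set.Ioo 0 π, (Zθ θ ^ 2 * ((weightDen θ : ℝ) : ℂ)) ^ K ≠ 0 := fun θ hθ =>
    pow_ne_zero _ (mul_ne_zero (pow_ne_zero _ (Zθ_ne_zero θ)) (by exact_mod_cast weightDen_ne_zero_of_mem_Ioo hθ))
  by_cases hP0 : P = 0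
  · left
    intro θ hθ
    have := key θ hθ
    rw [hP0, eval_zero] at this
    exact (mul_eq_zero.1 this).resolve_left (hA θ hθ)
  · right
    have hR0 : R ≠ 0 := mul_ne_zero (pow_ne_zero _ X_ne_zero) hP0
    have hQ0 : Q ≠ 0 := by intro h; apply hR0; rw [← hRQ, h, map_zero]
    have hdegR : R.natDegree ≤ 4 * K + 2 := by
      refine (natDegree_mul_le).trans ?_
      have h1 : (X ^ rootParity a : ℂ[X]).natDegree ≤ 1 := by
        rw [natDegree_X_pow]; unfold rootParity; split_ifs <;> simp
      have h2 : P.natDegree ≤ 4 * K + 1 := natDegree_ybVFPoly_le_of_le_cost Dl a f₀ le_rfl fun _ _ => Nat.zero_le _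
      omega
    have hdegQ : Q.natDegree ≤ 2 * K + 1 := (natDegree_contract_two_le hdegR).trans (by omega)
    set S := {θ ∈ Set.Ioo 0 π | vertexFunctional (printedWeights θ) tFiveEighths (ybCoeff θ) Dl a f₀ = 0} with hS
    have hmaps : ∀ θ ∈ S, Zθ θ ^ 2 ∈ (Q.roots.toFinset : Set ℂ) := by
      intro θ hθ
      rw [Finset.mem_coe, Multiset.mem_toFinset, mem_roots hQ0, IsRoot.def, ← expand_eval 2 Q (Zθ θ), hRQ, hR,
        eval_mul, ← key θ hθ.1, hθ.2, mul_zero, mul_zero]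
    have hinj : Set.InjOn (fun θ => Zθ θ ^ 2) S := fun θ₁ h₁ θ₂ h₂ h => eq_of_Zθ_sq_eq h₁.1 h₂.1 h
    have hfin : S.Finite :=
      Set.Finite.of_finite_image ((Finset.finite_toSet _).subset (Set.image_subset_iff.2 hmaps)) hinj
    refine ⟨hfin, ?_⟩
    calc S.ncard ≤ (Q.roots.toFinset : Set ℂ).ncard := Set.ncard_le_ncard_of_injOn _ hmaps hinj
      _ = Q.roots.toFinset.card := Set.ncard_coe_finset _
      _ ≤ Multiset.card Q.roots := Multiset.toFinset_card_le _
      _ ≤ Q.natDegree := card_roots' Q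
      _ ≤ 2 * K + 1 := hdegQ

end CostParity

end Literature.Barriers.CriticalPhenomena.PlaquetteWalk
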